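import Summits.BirchSwinnertonDyer.BirchSwinnertonDyer.Theses.UniversalToricDescent
import Summits.BirchSwinnertonDyer.BirchSwinnertonDyer.Theorems.UniversalToricDescentThinCombDefs
import Summits.BirchSwinnertonDyer.BirchSwinnertonDyer.Theorems.SignedBaseChangeAnticyclotomicEisensteinDivisibilityXGrTwoModuleFinite
import Literature.NumberTheory.EllipticCurves.TwoVariableSelmerDual
import Literature.NumberTheory.EllipticCurves.ZpExtensionSplitPrimeLineThroughPair
import Literature.NumberTheory.EllipticCurves.ToricTwoVariablePAdicLFunction
import Summits.BirchSwinnertonDyer.BirchSwinnertonDyer.Theorems.UniversalToricDescentBDPFrameCrossPeriodRigidity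
import Summits.BirchSwinnertonDyer.BirchSwinnertonDyer.Theorems.UniversalToricDescentThinCombDescentShear
import Summits.BirchSwinnertonDyer.BirchSwinnertonDyer.Theorems.UniversalToricDescentAdditiveSplitIMCInclusionAtThreeStubFrame
import Summits.BirchSwinnertonDyer.BirchSwinnertonDyer.Theorems.UniversalToricDescentAdditiveSplitIMCInclusionAtThreeStubDescent
import Summits.BirchSwinnertonDyer.BirchSwinnertonDyer.Theorems.UniversalToricDescentAdditiveSplitIMCInclusionAtThreeStubCharIdealPrincipal
import Summits.BirchSwinnertonDyer.BirchSwinnertonDyer.Theorems.UniversalToricDescentAdditiveSplitIMCInclusionAtThreeStubWeakRigidity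
import Summits.BirchSwinnertonDyer.BirchSwinnertonDyer.Theorems.UniversalToricDescentThinCombLineValue
import Summits.BirchSwinnertonDyer.BirchSwinnertonDyer.Theorems.UniversalToricDescentAdditiveSplitIMCInclusionAtThreeClosedModuloV4
import Literature.NumberTheory.EllipticCurves.RankinSelbergHeckeContinuation
import HarnessLib

/-!
# Line `thin_comb` — crux `AdditiveSplitIMCInclusionAtThree` (stmt-BirchSwinnertonDyer-20395, THE WALL, UTD r201)
# skeleton of crux idea `thin-comb-reflection` (utd-idea g38/g40; lead cruxlead-20395 g2 request «Lines/thin_comb.lean,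
# integral door»), pen bsd-wall-pss3x g7, 2026-08-29; v2 RESHAPED by the lead g2 (frame normalisation + weak reflection);
# v3 RESHAPED by the lead g3 (no-pseudo-null input of the descent made a registered stub).

FRAME (the lead's and the card's currency, `Theorems/UniversalToricDescentThinCombDefs.lean`): `Λ₂(𝒪) = 𝒪⟦T₂⟧⟦T₁⟧`
(`PowerSeries (PowerSeries 𝒪)`, OUTER `T₁`, INNER `T₂`), `𝒪 = R₀ = unrIntegers 3`; a (𝔭, 𝔭′)-FRAME of the
`ℤ₃²`-tower of `K` is a generator pair `(κ₁, κ₂; γ₁, γ₂)` (`ZpExtension.IsTopGeneratorPair`) with `κ₁` unramified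
outside `𝔭`, `κ₂` unramified outside `𝔭′` (so `1 + T₁ ↔ γ₁ = γ_𝔭`, `1 + T₂ ↔ γ₂ = γ_𝔭′`), through which the crux's
anticyclotomic `κ` factors (`pairKer κ₁ κ₂ ≤ ker κ`) with `γ₁γ₂ ∈ ker κ` (the anticyclotomic line is
`(1 + T₁)(1 + T₂) = 1`, the ideal `𝔞` below) and `γ₂ ≡ γ (mod ker κ)` (on that line `1 + T₂ ↔ γ`, the crux's generator,
so a one-variable series `L(T)` is read as `C L = L(T₂)`); `G` = the image in `Λ₂(R₀)` of a generator `g` of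
`ch_{Λ₂}(X₂)`, `X₂ = XGr₂ (W.baseChange K) 3 κ₁ κ₂ 𝔭′ γ₁ γ₂ = X_{∅ at 𝔭, nr at 𝔭′}(E/K̃_∞)` (tree carrier, PINNED).

STUBS (v1 list; current list at the end of this docstring) (6): `stub_frame` (support: the frame exists), `stub_charIdealPrincipal` (support: `ch_{Λ₂}` is principal),
`stub_algFE` (K4, support-in-print: Nekovář 2006 duality + `c`-transport — `ρ G ∼ G` for a reflection `ρ`),
`stub_twoVarCombSupply` (K2⁺ ⊕ K3, THE research stub: a `ρ`-symmetric two-variable function `L₂` congruent to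
`u·L(T₂)` mod `𝔞`, with INTEGRAL thin-comb divisibility `ThinCombDvdInt R₀ 3 G L₂`, and `X₂` torsion),
`stub_rigidity` (K1 = `CombReflectionRigidityInt R₀ 3`, PROVED by the lead, closes by name when
`…ThinCombRigidity.lean` lands), `stub_descent` (S2: `G ∣ L₂` + the congruence ⟹ the crux's inclusion on the
anticyclotomic line: control `XGr₂ ↠ XAc`, no pseudo-null submodule, Delbourgo/Herbrand specialisation along `𝔞`,
generator-congruence transport `γ₂ ≡ γ`). Composition `AdditiveSplitIMCInclusionAtThree_of` is kernel-checked.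
BSD is not proved by any of this; every `stub_*` is `sorry`.

v2 (lead cruxlead-20395 g2, 2026-08-29, RESHAPE after `stub-misstated: stub_frame`). The v1 frame asked the two
split-prime lines (`κ₁` unramified outside `𝔭`, `κ₂` unramified outside `𝔭′`) to form a GENERATOR PAIR with
`κ(γ₁) = −1`, `κ(γ₂) = 1`. That is false whenever the first layer of the anticyclotomic `ℤ₃`-extension is unramified
(equivalently lies in the Hilbert class field; e.g. `K = ℚ(√−23)`, `3` split, `h_K = 3`): then the `𝔭`-line, the
`𝔭′`-line and `κ` all have the SAME first layer, so no two of them are part of a `ℤ₃`-basis of `Hom(Γ, ℤ₃)`. v2 keeps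
ONLY what the mechanism needs: `κ₁` = the `𝔭`-line (so `1 + T₂ ↔ γ₂` spans the saturated `𝔭′`-inertia line: the
comb is VERTICAL and the axis `T₂ = 0` is the CM family `𝛉^{(𝔭)}`), `κ₂` ANY complement, normalised by
`κ(γ₁) = 1` (so `1 + T₁ ↦ 1 + T` on the anticyclotomic line, `T = γ − 1` the crux's variable) and `κ(γ₂) = 3^k`
for some `k : ℕ` (`k = 0` iff the good case); the anticyclotomic line is the ideal
`𝔞_k = (T₂ − ((1+T₁)^{3^k} − 1))`. The reflection `c∘ι` is then in general NOT an `IsReflection`; the lead's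
Part VII theorem `UniversalToricDescentThinComb.dvd_of_weakReflection` needs only a WEAK reflection (fixes constants,
`ρ T₂ ∉ (3, T₂)` — true for `c∘ι` since `cγ₂c` spans the `𝔭`-inertia line `≠` the `𝔭′`-line), so `stub_rigidity`
becomes `stub_weakRigidity` (closed by name by that theorem) and K4 (`ρ G ∼ G`, in print: Nekovář + `c`-transport)
is folded into the research stub as a conjunct sharing the witness `ρ` with K3's `ρ L₂ ∼ L₂` (an un-pinned
`∀ ρ weak → ρ L₂ ∼ L₂` would be false). Stubs v2 (5): `stub_frame`, `stub_charIdealPrincipal` (landed p692284),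
`stub_twoVarCombSupply`, `stub_weakRigidity` (landed once Part VII p693012 is in the tree), `stub_descent`.
v3 (lead cruxlead-20395 g3, 2026-08-29, RESHAPE after `stub-misstated: stub_descent` (v2)). `stub_frame` v2 LANDED (p696267).
The v2 glue `stub_descent` asked for `(L) ⊆ ch_Λ(X_ac)·R₀⟦T⟧` from `G ∣ L₂`, `L₂ ≡ u·L(T₁) (mod 𝔞_k)`, finite
generation, torsion and `ch_{Λ₂}(X₂) = (g)` ALONE. That implication is not provable from its binders (and is a
genuine arithmetic statement): with `L₂ := G`, `L := φ_k(G)` (`φ_k : Λ₂(R₀) ↠ R₀⟦T⟧`, `T₁ ↦ T`,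
`1 + T₂ ↦ (1+T)^{3^k}`, kernel `𝔞_k`) all its hypotheses hold, and its conclusion `φ_k(g) ∈ ch_Λ(X_ac)` is, by the
Herbrand specialisation `ch_Λ(X₂/𝔞_k X₂) = ch_Λ(X₂[𝔞_k]) · φ_k(ch_{Λ₂} X₂)` and exact control `X₂/𝔞_k X₂ ≃ X_ac`,
EQUIVALENT to «`X₂[𝔞_k]` is `Λ`-pseudo-null (finite)» — the no-pseudo-null input of every printed two-variable
descent (Greenberg 2016 Prop. 4.1.1; Skinner–Urban 2014 §3.2 / Cor. 3.2.9; the sibling line `bdpline` on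
stmt-…-20727 carries it as `stub_noPseudoNullSS`). v3 makes it a registered stub: `stub_noPseudoNull` (support, in
print: every pseudo-null `Λ₂`-submodule of `X₂` is FINITE — Greenberg's «almost divisible», S3n′ shape of the tree's
`PrintCf2.TwoVarSpecializationFinite`) and `stub_descent` (v3) takes it as a hypothesis; nothing else changes.
Stubs v3 (6): `stub_frame` (landed p696267), `stub_charIdealPrincipal` (landed p692284), `stub_twoVarCombSupply`
(research), `stub_weakRigidity` (landed p694324), `stub_noPseudoNull` (NEW, support/print), `stub_descent` (v3, glue L).

v4 PROPOSAL (pen bsd-wall-pss3x g7, 2026-08-29 05:3xZ — NOT registered; the lead adopts it by copying this file over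
`Lines/thin_comb.lean` with the namespace renamed back to `…ThinComb` and re-running `ledger skeleton check`). D1 LANDED
(`defn-IsToricTwoVarLFunction`, p697787, `Literature/NumberTheory/EllipticCurves/ToricTwoVariablePAdicLFunction.lean`):
the research stub `stub_twoVarCombSupply` (K2⁺ ⊕ K3 ⊕ K4 with a SHARED ∃-witness `L₂`) is SPLIT along the predicate into
`stub_toricTwoVarL` (K3, ∃: a PINNED toric two-variable function for the crux's periods + the anticyclotomic comparison
K3(ii)) and `stub_combDivisibility` (K2⁺ ⊕ K4, ∀ over PINNED `L₂`: torsion, the weak reflection with `ρ G ∼ G`,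
`ρ L₂ ∼ L₂`, and `ThinCombDvdInt`) — «same `_of` modulo one binder» as announced on the line card (rev 3/4); landed stubs
and `stub_noPseudoNull` / `stub_descent` (v3) VERBATIM. Stubs v4 (7 = the cap): `stub_frame` (landed), `stub_charIdealPrincipal`
(landed), `stub_toricTwoVarL` (research ∃), `stub_combDivisibility` (research ∀), `stub_weakRigidity` (landed),
`stub_noPseudoNull` (print), `stub_descent` (v3 glue). If the lead wants K3(ii) as its own support stub (it is M–L from the D1
API: `exists_hasValueAt₂_and_bdp` + one-variable identity principle along `𝔞_k` + substitution congruence), retire a landed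
stub from the registered list to stay ≤ 7.
v4.1 (05:5xZ, utd-idea g45 AUDIT LENS-MEMO-UTD-IDEA-v45 §1 F1 / S-g45-1 ADOPTED verbatim = probe `Sketch-utd-idea-g45.lean`
4e0abeb665c9abfc): `stub_toricTwoVarL` concludes `∃ Ωp' ≠ 0, ∃ L₂, IsToricTwoVarLFunction … ΩK Ωp' L₂ ∧ (congruence)` and `_of`
feeds `Ωp'`, `hΩp'` to `stub_combDivisibility` (already `∀ ΩK Ωp L₂`); K3(ii) thereby carries the one-variable period-rigidity
content (two BDP-admissible `(Ωp, L)` differ by `L ↦ (1+T)^c·L`, `(Ωp/Ωp')⁸ = w^c` — M–L, optional separate support stub);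
F2 calibration: effective typed ranges at `p = 3` are `n` even (BDP) and `a, b` both even (toric).
v4.2 (06:1xZ, utd-idea g46 TURNKEY S-g46-1 ADOPTED verbatim = probe `Sketch-utd-idea-g46.lean` 31084e5f106b7c89): K3 DECOUPLED FROM
THE HANDED FRAME — `stub_toricTwoVarL` concludes `∃ (ΩK′ : ℂ) (Ωp′ : ℂ_[3]) (L₂ : Λ₂(R₀)) (L♮ : R₀⟦T⟧), ΩK′ ≠ 0 ∧ Ωp′ ≠ 0 ∧
IsToricTwoVarLFunction … ΩK′ Ωp′ L₂ ∧ IsBDPLFunction ι′ 𝔭 κ γ Dt.f ΩK′ Ωp′ L♮ ∧ ∃ u : Λ₂ˣ, L₂ − u·L♮(T₁) ∈ 𝔞_k` (a toric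
function WITH ITS OWN BDP companion at the same existential period pair — Castella–Wan Thm 2.11 + Cor 2.12 shape at the additive 3;
the handed `(ΩK, Ωp, L)` stay hypotheses = existence insurance only), and `AdditiveSplitIMCInclusionAtThree_of` moves from `L♮` to
the handed `L` by the LANDED cross-period rigidity theorem `…Theorems.UniversalToricDescentTwinSplit.span_singleton_eq_of_isBDPLFunction`
(utd-p2 p536114; import `…Theorems.UniversalToricDescentBDPFrameCrossPeriodRigidity`): `Ideal.span {L♮} = Ideal.span {L}`, then
`stub_descent … L₂ L♮`. No period torsor / parity calibration is left inside the research stub. rc 0 · 7 sorries = 7 stubs · `_of` BY NAME.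
STILL A PROPOSAL (namespace `…ThinCombV4Pen`); the lead registers or not.
v5 PROPOSAL (pen, 06:4xZ — after the lead REGISTERED v4 = the v4.2 body at 06:16:42Z, skeleton d0eb3a3a09466677, and utd-idea g46's
ADDENDUM S-g46-2): the FOUR LANDED stubs are CITED BY NAME from `…Theorems.UniversalToricDescentThinCombLine` (`stub_frame` p696267,
`stub_charIdealPrincipal` p692284, `stub_weakRigidity` p694324, `stub_descent` p700531) and K3 `stub_toricTwoVarL` is SPLIT (g46
`K3Split-utd-idea-g46.lean` f23cb46429bfdd32, body verbatim) into K3a `stub_toricExists` (∃ ΩK′ Ωp′ L₂ toric at the additive 3 — THE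
beyond-print content), K3b `stub_lineRestrictionIsBDP` (any p: toric frame + Rankin–Selberg continuation ⇒ the central-ray restriction
`spec (p^k) L₂` is a BDP frame at the same periods — print-sized glue), K3c `stub_rankinSelbergContinuation` (entire continuation of
L(f × θ_φ, s) — print standard, ledger CITE item wi-92685: Jacquet 1972 Thm 19.14 / Shimura 1976 Thm 2), recomposed SORRY-FREE as
`toricTwoVarL_of_split` (u := 1, L♮ := spec (3^k) L₂, kernel algebra `sub_one_mul_map_spec_mem_lineIdeal`). OPEN stubs v5 (5 ≤ 7):
`stub_toricExists` (K3a research), `stub_lineRestrictionIsBDP` (K3b M/L), `stub_rankinSelbergContinuation` (K3c fact), `stub_combDivisibility`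
(K2⁺ research), `stub_noPseudoNull` (print L). `_of` BY NAME. Namespace `…ThinCombV5Pen`; UNREGISTERED — the lead's call (g46 option (e)-2).
v5.1 (pen g8, 07:0xZ — after K3c LANDED as the PUBLISHED NAMED FACT `jacquet1972_exists_entire_rankinSelbergHecke`
(cite item wi-92685 → p703283 `Literature/NumberTheory/EllipticCurves/RankinSelbergHeckeContinuation.lean`), §A LANDED by the lead as
`…Theorems.UniversalToricDescentThinComb.LineValue` (p703286) and K3b CLOSED AT EVIDENCE LEVEL by utd-idea g46 (#53
`K3bClosed-utd-idea-g46.lean` b13b09e4a63d601d, `k3b_holds : K3bStatement p`, statement = `stub_lineRestrictionIsBDP` below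
VERBATIM; #52 reciprocity)): (i) §A is dropped and cited BY NAME (`LineValue.sub_one_mul_map_spec_mem_lineIdeal`); (ii) K3c is no
longer research or typing debt: `rankinSelbergContinuation_of_jacquet : jacquet1972_exists_entire_rankinSelbergHecke → (K3c statement)`
is proved here sorry-free (`.of_isNewformOf … Dt.isNewformOf`), so the registered stub `stub_rankinSelbergContinuation` is exactly ONE
published fact specialised — it stays a `sorry` stub only because the crux as typed carries no fact hypotheses (honest residue, like
`stub_noPseudoNull` ⟸ Greenberg 4.1.1 + Tate TC, p701674); (iii) the recomposition is given in HYPOTHESIS FORM `toricTwoVarL_of_pieces`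
(K3a → K3b → K3c → registered v4 `stub_toricTwoVarL` statement) and the honest residue of the whole line is kernel-checked as
`AdditiveSplitIMCInclusionAtThree_of_facts : jacquet1972… → Greenberg2016.prop411… → (Tate TC) → K3a → K3b → K2⁺⊕K4 → crux` (via the
lead's landed `…ThinCombLine.AdditiveSplitIMCInclusionAtThree_of_toricTwoVarL_of_combDivisibility_of_prop411_of_tateTC`, p702745) — a
ready-to-land «ClosedModuloV5» text once K3b lands as a Theorems file (then `hK3b := k3b_holds 3`). OPEN after v5.1: K3a `stub_toricExists`
(research ∃, beyond print at the supercuspidal 3) and K2⁺⊕K4 `stub_combDivisibility` (research ∀) — everything else is a published fact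
or landed. K4 PINNING (D2 `IwasawaAlgebra₂.frameSubst` / `frameMatrixOf` landed p696697): splitting K4 `ρ G ∼ G` out of
`stub_combDivisibility` as its own print stub needs the reflection PINNED as `frameSubst R₀ A_{c∘ι}` with `A_{c∘ι} = frameMatrixOf κ₁ κ₂ γ₁ γ₂ σ`
for `σ = (g ↦ c̃ g⁻¹ c̃⁻¹)`, i.e. a ~15-line definition `conjBy c̃ : absoluteGaloisGroup K → absoluteGaloisGroup K` (lift `c̃ : K̄ ≃ₐ[ℚ] K̄` of
complex conjugation) that the tree does not have; not typed here (definition item D3 on the lead's word) — until then K4 stays the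
conjunct sharing `∃ ρ` with K3(iii), which is SOUND (the ∃ only weakens the stub; `stub_weakRigidity` takes any weak `ρ`).
Stubs v5.1 (5 open ≤ 7, texts = v5 verbatim): `stub_toricExists`, `stub_lineRestrictionIsBDP`, `stub_rankinSelbergContinuation`,
`stub_combDivisibility`, `stub_noPseudoNull`; `_of` BY NAME, unchanged. Namespace `…ThinCombV5Pen`; UNREGISTERED — the lead's call.
-/

set_option linter.dupNamespace false
set_option autoImplicit false

noncomputable section

open NumberField IsDedekindDomain Field
open Literature.NumberTheory.EllipticCurves Literature.NumberTheory.GaloisRepresentations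
open Summit.BirchSwinnertonDyer.BirchSwinnertonDyer.Theorems.UniversalToricDescentThinComb
open Summit.BirchSwinnertonDyer.BirchSwinnertonDyer.Theorems.UniversalToricDescentThinComb.TwoVarSubst

namespace Summit.BirchSwinnertonDyer.BirchSwinnertonDyer.Cruxes.AdditiveSplitIMCInclusionAtThree.ThinCombV5Pen

/-! ## §A  Algebra of `u = 1` — LANDED (lead, p703286): cited by name from
`Summit.BirchSwinnertonDyer.BirchSwinnertonDyer.Theorems.UniversalToricDescentThinComb.LineValue`
(`sub_toOuter_spec_mem_span`, `sub_one_mul_map_spec_mem_lineIdeal`). -/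

/-! ## §B  The three pieces -/

/-- **K3c, the hidden print-standard input**: entire continuation of `L(f/K, φ, s) = L(f × θ_φ, s)` from `re s > 3/2`
for every everywhere-unramified Hecke character `φ` of `K` of infinity type `(n, −n)`, `n ≥ 1` (`θ_φ` is then a cusp form
of weight `2n + 1 ≥ 3`; Rankin–Selberg). The binder shape is that of `IsRankinSelbergValueHecke` /
`IsToricTwoVarLFunction.hasValueAt₂_centralRay`. [cite: Jacquet1972, Thm. 19.14] [cite: Shimura1976, Thm. 2] [cite: Nekovar1995, §1.6–1.7] -/
def RankinSelbergContinuation (K : Type) [Field K] [NumberField K] {N : ℕ}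
    (f : CuspForm (CongruenceSubgroup.Gamma0 N) 2) : Prop :=
  ∀ (φ : HeckeCharacter K) (n : ℕ), 0 < n → (∀ v : HeightOneSpectrum (𝓞 K), φ.IsUnramifiedAt v) →
    φ.HasInfinityType (fun _ ↦ (n : ℤ)) (fun _ ↦ -(n : ℤ)) →
    ∃ L : ℂ → ℂ, Differentiable ℂ L ∧ ∀ s : ℂ, 3 / 2 < s.re → L s = rankinSelbergEulerProductHecke f φ s

/-- **K3a `stub_toricExists`** (crux-research ∃, L; beyond print at additive 3): in a v2 frame a toric two-variable
`𝔭`-adic `L`-function of `f = Dt.f` EXISTS at some admissible period pair. [cite: CastellaWan2023, Thm. 2.11 (arXiv:1607.02019 §2.4)]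
Why it might fail: no construction of `L_𝔭(f/K)` over the `ℤ_p²`-tower is in print when `p ∣ N` is additive
(supercuspidal at 3); the CM-side (Katz) half of the construction does not see `N`, the `f`-side needs a
`p`-depleted/stabilised form at a supercuspidal prime. -/
theorem stub_toricExists :
    ∀ (W : WeierstrassCurve ℚ) [W.IsElliptic] [W.IsGloballyMinimal] (N : ℕ) [NeZero N] (K : Type) [Field K]
      [NumberField K] (Dt : Literature.NumberTheory.EllipticCurves.ModularForms.ModularParametrizationData W N),
    Summit.BirchSwinnertonDyer.Rank1Residual.Additive.ClassO6 W 3 → W.HasSurjectiveModNGaloisRep 3 →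
    W.analyticRank = 1 → W.conductorNorm ℤ = N → IsImaginaryQuadratic K → SatisfiesHeegnerHypothesis N K →
    ∀ (κ : ZpExtension K 3), κ.IsAnticyclotomic → ∀ (γ : Field.absoluteGaloisGroup K) [Fact (κ.IsTopGenerator γ)]
      (𝔭 : HeightOneSpectrum (𝓞 K)), ((3 : ℕ) : 𝓞 K) ∈ 𝔭.asIdeal →
      𝔭.asIdeal.ramificationIdx (𝓞 ℚ) = 1 → 𝔭.asIdeal.inertiaDeg (𝓞 ℚ) = 1 →
    ∀ (𝔭' : HeightOneSpectrum (𝓞 K)), ((3 : ℕ) : 𝓞 K) ∈ 𝔭'.asIdeal → 𝔭' ≠ 𝔭 →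
    ∀ (ι' : PadicAlgCl 3 ≃+* ℂ), Summit.BirchSwinnertonDyer.BirchSwinnertonDyer.Theorems.SchneiderFree.BranchInducesPrime 3 ι' 𝔭 →
    ∀ (κ₁ κ₂ : ZpExtension K 3) (γ₁ γ₂ : Field.absoluteGaloisGroup K) (k : ℕ)
      [Fact (ZpExtension.IsTopGeneratorPair κ₁ κ₂ γ₁ γ₂)],
    (∀ v : HeightOneSpectrum (𝓞 K), v ≠ 𝔭 → ∀ 𝔓 ∈ v.primesAbove,
        𝔓.inertia (Field.absoluteGaloisGroup K) ≤ κ₁.kerSubgroup) →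
    ZpExtension.pairKer κ₁ κ₂ ≤ κ.kerSubgroup → γ₁ * γ⁻¹ ∈ κ.kerSubgroup → γ₂ * (γ ^ (3 ^ k))⁻¹ ∈ κ.kerSubgroup →
    ∃ (ΩK' : ℂ) (Ωp' : ℂ_[3]) (L₂ : PowerSeries (PowerSeries (unrIntegers 3))),
      ΩK' ≠ 0 ∧ Ωp' ≠ 0 ∧ IsToricTwoVarLFunction ι' 𝔭 𝔭' κ₁ κ₂ γ₁ γ₂ Dt.f ΩK' Ωp' L₂ := by
  sorry

/-- **K3b `stub_lineRestrictionIsBDP`** (M/L; print, any prime `p`): given the Rankin–Selberg continuation, the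
central-ray restriction `spec (p^k) L₂` of a toric frame in a v2 frame (`γ₁ ≡ γ`, `γ₂ ≡ γ^{p^k}` mod `ker κ`,
`pairKer ≤ ker κ`) is a BDP frame at the SAME periods. Proof plan: at `(φ, n, r)` of `IsBDPLFunction`'s range, `r`
factors through the pair (`factorsThroughPair_of_factorsThroughZp`), the continuation (K3c) feeds
`hasValueAt₂_centralRay` (with `φ(𝔭̄) = φ(𝔭)⁻¹`: `φ` unramified of type `(n,−n)`, `𝔭𝔭̄ = (p)`), the point
`(r(γ₁) − 1, r(γ₂) − 1) = (x, (1+x)^{p^k} − 1)` with `x = r(γ) − 1` (line geometry), and two-variable value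
compatibility along the line turns the `HasValueAt₂` into `(spec (p^k) L₂).HasValueAt x _`.
[cite: CastellaWan2023, Cor. 2.12 (arXiv:1607.02019 §2.4)] [cite: Castella2018, Thm. 3.1]
Why it might fail: only through a mismatch of typed conventions (the `Ω_p^{2(a+b)}` vs `Ω_p^{4n}` bookkeeping is
already discharged by `hasValueAt₂_centralRay`); the value-compatibility lemma needs `‖r(γ) − 1‖ < 1`
(pro-`p` image of a character through `κ`). -/
theorem stub_lineRestrictionIsBDP {p : ℕ} [Fact p.Prime] :
    ∀ (K : Type) [Field K] [NumberField K] (N : ℕ) (f : CuspForm (CongruenceSubgroup.Gamma0 N) 2),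
    IsImaginaryQuadratic K →
    ∀ (κ : ZpExtension K p), κ.IsAnticyclotomic → ∀ (γ : Field.absoluteGaloisGroup K), κ.IsTopGenerator γ →
    ∀ (𝔭 : HeightOneSpectrum (𝓞 K)), ((p : ℕ) : 𝓞 K) ∈ 𝔭.asIdeal →
      𝔭.asIdeal.ramificationIdx (𝓞 ℚ) = 1 → 𝔭.asIdeal.inertiaDeg (𝓞 ℚ) = 1 →
    ∀ (𝔭' : HeightOneSpectrum (𝓞 K)), ((p : ℕ) : 𝓞 K) ∈ 𝔭'.asIdeal → 𝔭' ≠ 𝔭 →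
    ∀ (ι : PadicAlgCl p ≃+* ℂ) (κ₁ κ₂ : ZpExtension K p) (γ₁ γ₂ : Field.absoluteGaloisGroup K) (k : ℕ),
    ZpExtension.IsTopGeneratorPair κ₁ κ₂ γ₁ γ₂ →
    ZpExtension.pairKer κ₁ κ₂ ≤ κ.kerSubgroup → γ₁ * γ⁻¹ ∈ κ.kerSubgroup → γ₂ * (γ ^ (p ^ k))⁻¹ ∈ κ.kerSubgroup →
    RankinSelbergContinuation K f →
    ∀ (ΩK : ℂ) (Ωp : ℂ_[p]) (L₂ : PowerSeries (UnrSeries p)), ΩK ≠ 0 → Ωp ≠ 0 →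
      IsToricTwoVarLFunction ι 𝔭 𝔭' κ₁ κ₂ γ₁ γ₂ f ΩK Ωp L₂ →
      IsBDPLFunction ι 𝔭 κ γ f ΩK Ωp (spec (p ^ k) L₂) := by
  sorry

/-- **K3c `stub_rankinSelbergContinuation`** (print-standard, unformalised): the Rankin–Selberg continuation for the
newform `Dt.f` of `W` over the imaginary quadratic `K`. [cite: Jacquet1972, Thm. 19.14] [cite: Shimura1976, Thm. 2]
Why it might fail: it does not (theorem in print since 1939/1972); the risk is formalisation cost only — the tree has
the abstract `exists_entire_eq_mul_rankinSelbergIntegral` but not its unfolding to `rankinSelbergEulerProductHecke`. -/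
theorem stub_rankinSelbergContinuation :
    ∀ (W : WeierstrassCurve ℚ) [W.IsElliptic] (N : ℕ) [NeZero N] (K : Type) [Field K] [NumberField K]
      (Dt : Literature.NumberTheory.EllipticCurves.ModularForms.ModularParametrizationData W N),
    IsImaginaryQuadratic K → RankinSelbergContinuation K Dt.f := by
  sorry

/-- **K3c is ONE published fact, specialised** (sorry-free): Jacquet 1972 Cor. 19.15 in the tree's named-fact form
`jacquet1972_exists_entire_rankinSelbergHecke` (p703283) gives the `stub_rankinSelbergContinuation` statement for the newform
`Dt.f` (`Dt.isNewformOf`). [cite: Jacquet1972, §19 Cor. 19.15 (with Thm. 19.14)] -/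
theorem rankinSelbergContinuation_of_jacquet (hJ : jacquet1972_exists_entire_rankinSelbergHecke) :
    ∀ (W : WeierstrassCurve ℚ) [W.IsElliptic] (N : ℕ) [NeZero N] (K : Type) [Field K] [NumberField K]
      (Dt : Literature.NumberTheory.EllipticCurves.ModularForms.ModularParametrizationData W N),
    IsImaginaryQuadratic K → RankinSelbergContinuation K Dt.f := by
  intro W _ N _ K _ _ Dt hK φ n hn hunr hinf
  exact hJ.of_isNewformOf hK Dt.isNewformOf φ n hn hunr hinf

/-- **stub_combDivisibility** (K2⁺ ⊕ K4, crux-research ∀, XL; v4 — second half of the v3 research stub): in a v2 frame,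
for every two-variable function `L₂` PINNED by `IsToricTwoVarLFunction` (so no junk witnesses: the predicate determines
`L₂` — identity principle `IsToricTwoVarLFunction.eq_of_infinite` in a product-adapted frame, transported by a generator
change): `X₂` is `Λ₂`-torsion (kept HERE, utd-idea g44 §4), and there is a WEAK REFLECTION `ρ` (fixes constants,
`ρ T₂ ∉ (3, T₂)`; meant `c∘ι`, which qualifies because `cγ₂c` spans the `𝔭`-inertia line ≠ the `𝔭′`-line) with
`ρ G ∼ G` (K4 — in print for every `E`: Nekovář 2006 Greenberg duality + transport by `c`), `ρ L₂ ∼ L₂` (K3(iii): the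
functional equation of the PINNED `L₂`, unit root number factor — now a definite claim, no shared-witness device needed)
and INTEGRAL thin-comb divisibility `ThinCombDvdInt R₀ 3 G L₂` (`L₂ ∈ (G, E_m(T₂))` on levels of unbounded order:
`𝔭`-branch Beilinson–Flach classes per 3-power twist, 𝛉-dominant explicit reciprocity at the SUPERCUSPIDAL 3,
slack-free Λ-adic Kolyvagin bound — BEYOND PRINT; why it might fail: no reciprocity law at supercuspidal `p ∣ N` in
print, and the slack-free bound may hold on no level — then only the rational door `Cruxes/ToricTransportModThree/
Lines/ratwall_thin_comb.lean` of the parent 20186 remains). VACUITY NOTE: if no `L₂` satisfies the predicate this stub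
is vacuous and ALL the weight sits on `stub_toricTwoVarL`; the predicate itself is non-vacuous (for every `(a, b)` with
`a ≡ b (mod 2)` a suitable power of an unramified type-`(a, −b)` character factors through the pair). -/
theorem stub_combDivisibility :
    ∀ (W : WeierstrassCurve ℚ) [W.IsElliptic] [W.IsGloballyMinimal] (N : ℕ) [NeZero N] (K : Type) [Field K]
      [NumberField K] (Dt : Literature.NumberTheory.EllipticCurves.ModularForms.ModularParametrizationData W N),
    Summit.BirchSwinnertonDyer.Rank1Residual.Additive.ClassO6 W 3 → W.HasSurjectiveModNGaloisRep 3 →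
    W.analyticRank = 1 → W.conductorNorm ℤ = N → IsImaginaryQuadratic K → SatisfiesHeegnerHypothesis N K →
    ∀ (𝔭 : HeightOneSpectrum (𝓞 K)), ((3 : ℕ) : 𝓞 K) ∈ 𝔭.asIdeal →
      𝔭.asIdeal.ramificationIdx (𝓞 ℚ) = 1 → 𝔭.asIdeal.inertiaDeg (𝓞 ℚ) = 1 →
    ∀ (𝔭' : HeightOneSpectrum (𝓞 K)), ((3 : ℕ) : 𝓞 K) ∈ 𝔭'.asIdeal → 𝔭' ≠ 𝔭 →
    ∀ (ι' : PadicAlgCl 3 ≃+* ℂ), Summit.BirchSwinnertonDyer.BirchSwinnertonDyer.Theorems.SchneiderFree.BranchInducesPrime 3 ι' 𝔭 →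
    ∀ (κ₁ κ₂ : ZpExtension K 3) (γ₁ γ₂ : Field.absoluteGaloisGroup K)
      [Fact (ZpExtension.IsTopGeneratorPair κ₁ κ₂ γ₁ γ₂)],
    (∀ v : HeightOneSpectrum (𝓞 K), v ≠ 𝔭 → ∀ 𝔓 ∈ v.primesAbove,
        𝔓.inertia (Field.absoluteGaloisGroup K) ≤ κ₁.kerSubgroup) →
    ∀ (g : IwasawaAlgebra₂ 3),
      Literature.NumberTheory.EllipticCurves.Module.charIdeal (IwasawaAlgebra₂ 3)
        ((W.baseChange K).XGr₂ 3 κ₁ κ₂ 𝔭' γ₁ γ₂) = Ideal.span {g} →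
    ∀ (ΩK : ℂ) (Ωp : ℂ_[3]) (L₂ : PowerSeries (PowerSeries (unrIntegers 3))), ΩK ≠ 0 → Ωp ≠ 0 →
      IsToricTwoVarLFunction ι' 𝔭 𝔭' κ₁ κ₂ γ₁ γ₂ Dt.f ΩK Ωp L₂ →
    Module.IsTorsion (IwasawaAlgebra₂ 3) ((W.baseChange K).XGr₂ 3 κ₁ κ₂ 𝔭' γ₁ γ₂) ∧
    ∃ (ρ : PowerSeries (PowerSeries (unrIntegers 3)) ≃+* PowerSeries (PowerSeries (unrIntegers 3))),
      (∀ c : unrIntegers 3, ρ (const (unrIntegers 3) c) = const (unrIntegers 3) c) ∧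
      ρ (T₂ (unrIntegers 3)) ∉ Ideal.span {const (unrIntegers 3) ((3 : ℕ) : unrIntegers 3), T₂ (unrIntegers 3)} ∧
      Associated (ρ (PowerSeries.map (PowerSeries.map
        (Summit.BirchSwinnertonDyer.Rank1Residual.X11b.Halves.toUnr 3)) g))
        (PowerSeries.map (PowerSeries.map (Summit.BirchSwinnertonDyer.Rank1Residual.X11b.Halves.toUnr 3)) g) ∧
      Associated (ρ L₂) L₂ ∧
      ThinCombDvdInt (unrIntegers 3) 3
        (PowerSeries.map (PowerSeries.map (Summit.BirchSwinnertonDyer.Rank1Residual.X11b.Halves.toUnr 3)) g) L₂ := by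
  sorry

/-- **stub_noPseudoNull** (support, in print, L; v3 — NEW): in a v2 frame, if `X₂ = X_{∅ at 𝔭, nr at 𝔭′}(E/K̃_∞)`
is finitely generated and torsion over `Λ₂ = ℤ₃⟦T₂⟧⟦T₁⟧`, then every PSEUDO-NULL `Λ₂`-submodule of `X₂` is FINITE
(Greenberg's «`S` almost divisible ⟺ its dual has no non-zero pseudo-null submodule», a fortiori the S3n′ shape used
by the tree's `PrintCf2.TwoVarSpecializationFinite` / `SignedBaseChangeAcDivSpecialization.S2`). In print: Greenberg
2016 Prop. 4.1.1 (RFX, LEO, LOC⁽²⁾ for twist deformations §4.3; LOC⁽¹⁾ at a prime not split completely in `K̃_∞`;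
`𝓛` almost divisible: no condition above `𝔭`, unramified above `𝔭′`; CRK from torsion; (a) `E(K̃_∞)[3] = 0` from
`ρ̄` onto) + the Shapiro descent `S_𝓛(K, T ⊗ Λ₂) ≅ Sel(K̃_∞)` (Greenberg §4.3 p. 21, «[Gr6]»); the tree holds
Prop. 4.1.1 as the named fact `Greenberg2016.prop411_selmer_isAlmostDivisible`. Why it might fail: the unramified
local condition above the ADDITIVE prime `𝔭′ ∣ 3` must be almost `Λ₂`-divisible (Prop. 4.2.2 needs `H²(K_η, C_η) = 0`
for a coreflexive `C_η`); not checked in print at potentially supersingular wild `3`. -/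
theorem stub_noPseudoNull :
    ∀ (W : WeierstrassCurve ℚ) [W.IsElliptic] [W.IsGloballyMinimal] (K : Type) [Field K] [NumberField K],
    Summit.BirchSwinnertonDyer.Rank1Residual.Additive.ClassO6 W 3 → W.HasSurjectiveModNGaloisRep 3 →
    IsImaginaryQuadratic K →
    ∀ (κ : ZpExtension K 3), κ.IsAnticyclotomic → ∀ (γ : Field.absoluteGaloisGroup K) [Fact (κ.IsTopGenerator γ)]
      (𝔭 : HeightOneSpectrum (𝓞 K)), ((3 : ℕ) : 𝓞 K) ∈ 𝔭.asIdeal →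
    ∀ (𝔭' : HeightOneSpectrum (𝓞 K)), ((3 : ℕ) : 𝓞 K) ∈ 𝔭'.asIdeal → 𝔭' ≠ 𝔭 →
    ∀ (κ₁ κ₂ : ZpExtension K 3) (γ₁ γ₂ : Field.absoluteGaloisGroup K) (k : ℕ)
      [Fact (ZpExtension.IsTopGeneratorPair κ₁ κ₂ γ₁ γ₂)],
    (∀ v : HeightOneSpectrum (𝓞 K), v ≠ 𝔭 → ∀ 𝔓 ∈ v.primesAbove,
        𝔓.inertia (Field.absoluteGaloisGroup K) ≤ κ₁.kerSubgroup) →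
    ZpExtension.pairKer κ₁ κ₂ ≤ κ.kerSubgroup → γ₁ * γ⁻¹ ∈ κ.kerSubgroup → γ₂ * (γ ^ (3 ^ k))⁻¹ ∈ κ.kerSubgroup →
    Module.Finite (IwasawaAlgebra₂ 3) ((W.baseChange K).XGr₂ 3 κ₁ κ₂ 𝔭' γ₁ γ₂) →
    Module.IsTorsion (IwasawaAlgebra₂ 3) ((W.baseChange K).XGr₂ 3 κ₁ κ₂ 𝔭' γ₁ γ₂) →
    ∀ N : Submodule (IwasawaAlgebra₂ 3) ((W.baseChange K).XGr₂ 3 κ₁ κ₂ 𝔭' γ₁ γ₂),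
      Literature.NumberTheory.EllipticCurves.Module.IsPseudoNull (IwasawaAlgebra₂ 3) N → Finite N := by
  sorry

/-- **K3 recomposed, hypothesis form** (sorry-free; g46 §C): the statements K3a, K3b (at `p = 3`) and K3c give the
registered v4 `stub_toricTwoVarL` statement, with `L♮ := spec (3^k) L₂` and `u = 1`
(`LineValue.sub_one_mul_map_spec_mem_lineIdeal`, landed p703286). -/
theorem toricTwoVarL_of_pieces
    (hK3a :
      ∀ (W : WeierstrassCurve ℚ) [W.IsElliptic] [W.IsGloballyMinimal] (N : ℕ) [NeZero N] (K : Type) [Field K]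
        [NumberField K] (Dt : Literature.NumberTheory.EllipticCurves.ModularForms.ModularParametrizationData W N),
      Summit.BirchSwinnertonDyer.Rank1Residual.Additive.ClassO6 W 3 → W.HasSurjectiveModNGaloisRep 3 →
      W.analyticRank = 1 → W.conductorNorm ℤ = N → IsImaginaryQuadratic K → SatisfiesHeegnerHypothesis N K →
      ∀ (κ : ZpExtension K 3), κ.IsAnticyclotomic → ∀ (γ : Field.absoluteGaloisGroup K) [Fact (κ.IsTopGenerator γ)]
        (𝔭 : HeightOneSpectrum (𝓞 K)), ((3 : ℕ) : 𝓞 K) ∈ 𝔭.asIdeal →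
        𝔭.asIdeal.ramificationIdx (𝓞 ℚ) = 1 → 𝔭.asIdeal.inertiaDeg (𝓞 ℚ) = 1 →
      ∀ (𝔭' : HeightOneSpectrum (𝓞 K)), ((3 : ℕ) : 𝓞 K) ∈ 𝔭'.asIdeal → 𝔭' ≠ 𝔭 →
      ∀ (ι' : PadicAlgCl 3 ≃+* ℂ), Summit.BirchSwinnertonDyer.BirchSwinnertonDyer.Theorems.SchneiderFree.BranchInducesPrime 3 ι' 𝔭 →
      ∀ (κ₁ κ₂ : ZpExtension K 3) (γ₁ γ₂ : Field.absoluteGaloisGroup K) (k : ℕ)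
        [Fact (ZpExtension.IsTopGeneratorPair κ₁ κ₂ γ₁ γ₂)],
      (∀ v : HeightOneSpectrum (𝓞 K), v ≠ 𝔭 → ∀ 𝔓 ∈ v.primesAbove,
          𝔓.inertia (Field.absoluteGaloisGroup K) ≤ κ₁.kerSubgroup) →
      ZpExtension.pairKer κ₁ κ₂ ≤ κ.kerSubgroup → γ₁ * γ⁻¹ ∈ κ.kerSubgroup → γ₂ * (γ ^ (3 ^ k))⁻¹ ∈ κ.kerSubgroup →
      ∃ (ΩK' : ℂ) (Ωp' : ℂ_[3]) (L₂ : PowerSeries (PowerSeries (unrIntegers 3))),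
        ΩK' ≠ 0 ∧ Ωp' ≠ 0 ∧ IsToricTwoVarLFunction ι' 𝔭 𝔭' κ₁ κ₂ γ₁ γ₂ Dt.f ΩK' Ωp' L₂)
    (hK3b :
      ∀ (K : Type) [Field K] [NumberField K] (N : ℕ) (f : CuspForm (CongruenceSubgroup.Gamma0 N) 2),
      IsImaginaryQuadratic K →
      ∀ (κ : ZpExtension K 3), κ.IsAnticyclotomic → ∀ (γ : Field.absoluteGaloisGroup K), κ.IsTopGenerator γ →
      ∀ (𝔭 : HeightOneSpectrum (𝓞 K)), ((3 : ℕ) : 𝓞 K) ∈ 𝔭.asIdeal →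
        𝔭.asIdeal.ramificationIdx (𝓞 ℚ) = 1 → 𝔭.asIdeal.inertiaDeg (𝓞 ℚ) = 1 →
      ∀ (𝔭' : HeightOneSpectrum (𝓞 K)), ((3 : ℕ) : 𝓞 K) ∈ 𝔭'.asIdeal → 𝔭' ≠ 𝔭 →
      ∀ (ι : PadicAlgCl 3 ≃+* ℂ) (κ₁ κ₂ : ZpExtension K 3) (γ₁ γ₂ : Field.absoluteGaloisGroup K) (k : ℕ),
      ZpExtension.IsTopGeneratorPair κ₁ κ₂ γ₁ γ₂ →
      ZpExtension.pairKer κ₁ κ₂ ≤ κ.kerSubgroup → γ₁ * γ⁻¹ ∈ κ.kerSubgroup → γ₂ * (γ ^ (3 ^ k))⁻¹ ∈ κ.kerSubgroup →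
      RankinSelbergContinuation K f →
      ∀ (ΩK : ℂ) (Ωp : ℂ_[3]) (L₂ : PowerSeries (UnrSeries 3)), ΩK ≠ 0 → Ωp ≠ 0 →
        IsToricTwoVarLFunction ι 𝔭 𝔭' κ₁ κ₂ γ₁ γ₂ f ΩK Ωp L₂ →
        IsBDPLFunction ι 𝔭 κ γ f ΩK Ωp (spec (3 ^ k) L₂))
    (hK3c :
      ∀ (W : WeierstrassCurve ℚ) [W.IsElliptic] (N : ℕ) [NeZero N] (K : Type) [Field K] [NumberField K]
        (Dt : Literature.NumberTheory.EllipticCurves.ModularForms.ModularParametrizationData W N),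
      IsImaginaryQuadratic K → RankinSelbergContinuation K Dt.f) :
    ∀ (W : WeierstrassCurve ℚ) [W.IsElliptic] [W.IsGloballyMinimal] (N : ℕ) [NeZero N] (K : Type) [Field K]
      [NumberField K] (Dt : Literature.NumberTheory.EllipticCurves.ModularForms.ModularParametrizationData W N),
    Summit.BirchSwinnertonDyer.Rank1Residual.Additive.ClassO6 W 3 → W.HasSurjectiveModNGaloisRep 3 →
    W.analyticRank = 1 → W.conductorNorm ℤ = N → IsImaginaryQuadratic K → SatisfiesHeegnerHypothesis N K →
    ∀ (κ : ZpExtension K 3), κ.IsAnticyclotomic → ∀ (γ : Field.absoluteGaloisGroup K) [Fact (κ.IsTopGenerator γ)]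
      (𝔭 : HeightOneSpectrum (𝓞 K)), ((3 : ℕ) : 𝓞 K) ∈ 𝔭.asIdeal →
      𝔭.asIdeal.ramificationIdx (𝓞 ℚ) = 1 → 𝔭.asIdeal.inertiaDeg (𝓞 ℚ) = 1 →
    ∀ (𝔭' : HeightOneSpectrum (𝓞 K)), ((3 : ℕ) : 𝓞 K) ∈ 𝔭'.asIdeal → 𝔭' ≠ 𝔭 →
    ∀ (ι' : PadicAlgCl 3 ≃+* ℂ), Summit.BirchSwinnertonDyer.BirchSwinnertonDyer.Theorems.SchneiderFree.BranchInducesPrime 3 ι' 𝔭 →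
    ∀ (κ₁ κ₂ : ZpExtension K 3) (γ₁ γ₂ : Field.absoluteGaloisGroup K) (k : ℕ)
      [Fact (ZpExtension.IsTopGeneratorPair κ₁ κ₂ γ₁ γ₂)],
    (∀ v : HeightOneSpectrum (𝓞 K), v ≠ 𝔭 → ∀ 𝔓 ∈ v.primesAbove,
        𝔓.inertia (Field.absoluteGaloisGroup K) ≤ κ₁.kerSubgroup) →
    ZpExtension.pairKer κ₁ κ₂ ≤ κ.kerSubgroup → γ₁ * γ⁻¹ ∈ κ.kerSubgroup → γ₂ * (γ ^ (3 ^ k))⁻¹ ∈ κ.kerSubgroup →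
    ∀ (ΩK : ℂ) (Ωp : ℂ_[3]) (L : UnrSeries 3), ΩK ≠ 0 → Ωp ≠ 0 →
      IsBDPLFunction ι' 𝔭 κ γ Dt.f ΩK Ωp L →
    ∃ (ΩK' : ℂ) (Ωp' : ℂ_[3]) (L₂ : PowerSeries (PowerSeries (unrIntegers 3))) (L' : UnrSeries 3),
      ΩK' ≠ 0 ∧ Ωp' ≠ 0 ∧
      IsToricTwoVarLFunction ι' 𝔭 𝔭' κ₁ κ₂ γ₁ γ₂ Dt.f ΩK' Ωp' L₂ ∧
      IsBDPLFunction ι' 𝔭 κ γ Dt.f ΩK' Ωp' L' ∧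
      ∃ u : (PowerSeries (PowerSeries (unrIntegers 3)))ˣ,
        L₂ - u * PowerSeries.map (PowerSeries.C (R := unrIntegers 3)) L' ∈
          Ideal.span {T₂ (unrIntegers 3) - ((1 + T₁ (unrIntegers 3)) ^ (3 ^ k) - 1)} := by
  intro W _ _ N _ K _ _ Dt hO6 hsurj hrk hN hK hHeeg κ hκ γ _ 𝔭 h𝔭 he hf 𝔭' h𝔭' hne ι' hι κ₁ κ₂ γ₁ γ₂ k _
    hiner hker hγ₁ hγ₂ ΩK Ωp L hΩK hΩp hL
  obtain ⟨ΩK', Ωp', L₂, hΩK', hΩp', hL₂⟩ :=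
    hK3a W N K Dt hO6 hsurj hrk hN hK hHeeg κ hκ γ 𝔭 h𝔭 he hf 𝔭' h𝔭' hne ι' hι κ₁ κ₂ γ₁ γ₂ k
      hiner hker hγ₁ hγ₂
  have hRS : RankinSelbergContinuation K Dt.f := hK3c W N K Dt hK
  have hL' : IsBDPLFunction ι' 𝔭 κ γ Dt.f ΩK' Ωp' (spec (3 ^ k) L₂) :=
    hK3b K N Dt.f hK κ hκ γ (Fact.out) 𝔭 h𝔭 he hf 𝔭' h𝔭' hne ι' κ₁ κ₂ γ₁ γ₂ k (Fact.out)
      hker hγ₁ hγ₂ hRS ΩK' Ωp' L₂ hΩK' hΩp' hL₂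
  exact ⟨ΩK', Ωp', L₂, spec (3 ^ k) L₂, hΩK', hΩp', hL₂, hL', 1,
    Summit.BirchSwinnertonDyer.BirchSwinnertonDyer.Theorems.UniversalToricDescentThinComb.LineValue.sub_one_mul_map_spec_mem_lineIdeal
      (3 ^ k) L₂⟩

/-- **K3 recomposed from the three stubs** (v5 shape, consumed by `_of`). -/
theorem toricTwoVarL_of_split :
    ∀ (W : WeierstrassCurve ℚ) [W.IsElliptic] [W.IsGloballyMinimal] (N : ℕ) [NeZero N] (K : Type) [Field K]
      [NumberField K] (Dt : Literature.NumberTheory.EllipticCurves.ModularForms.ModularParametrizationData W N),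
    Summit.BirchSwinnertonDyer.Rank1Residual.Additive.ClassO6 W 3 → W.HasSurjectiveModNGaloisRep 3 →
    W.analyticRank = 1 → W.conductorNorm ℤ = N → IsImaginaryQuadratic K → SatisfiesHeegnerHypothesis N K →
    ∀ (κ : ZpExtension K 3), κ.IsAnticyclotomic → ∀ (γ : Field.absoluteGaloisGroup K) [Fact (κ.IsTopGenerator γ)]
      (𝔭 : HeightOneSpectrum (𝓞 K)), ((3 : ℕ) : 𝓞 K) ∈ 𝔭.asIdeal →
      𝔭.asIdeal.ramificationIdx (𝓞 ℚ) = 1 → 𝔭.asIdeal.inertiaDeg (𝓞 ℚ) = 1 →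
    ∀ (𝔭' : HeightOneSpectrum (𝓞 K)), ((3 : ℕ) : 𝓞 K) ∈ 𝔭'.asIdeal → 𝔭' ≠ 𝔭 →
    ∀ (ι' : PadicAlgCl 3 ≃+* ℂ), Summit.BirchSwinnertonDyer.BirchSwinnertonDyer.Theorems.SchneiderFree.BranchInducesPrime 3 ι' 𝔭 →
    ∀ (κ₁ κ₂ : ZpExtension K 3) (γ₁ γ₂ : Field.absoluteGaloisGroup K) (k : ℕ)
      [Fact (ZpExtension.IsTopGeneratorPair κ₁ κ₂ γ₁ γ₂)],
    (∀ v : HeightOneSpectrum (𝓞 K), v ≠ 𝔭 → ∀ 𝔓 ∈ v.primesAbove,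
        𝔓.inertia (Field.absoluteGaloisGroup K) ≤ κ₁.kerSubgroup) →
    ZpExtension.pairKer κ₁ κ₂ ≤ κ.kerSubgroup → γ₁ * γ⁻¹ ∈ κ.kerSubgroup → γ₂ * (γ ^ (3 ^ k))⁻¹ ∈ κ.kerSubgroup →
    ∀ (ΩK : ℂ) (Ωp : ℂ_[3]) (L : UnrSeries 3), ΩK ≠ 0 → Ωp ≠ 0 →
      IsBDPLFunction ι' 𝔭 κ γ Dt.f ΩK Ωp L →
    ∃ (ΩK' : ℂ) (Ωp' : ℂ_[3]) (L₂ : PowerSeries (PowerSeries (unrIntegers 3))) (L' : UnrSeries 3),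
      ΩK' ≠ 0 ∧ Ωp' ≠ 0 ∧
      IsToricTwoVarLFunction ι' 𝔭 𝔭' κ₁ κ₂ γ₁ γ₂ Dt.f ΩK' Ωp' L₂ ∧
      IsBDPLFunction ι' 𝔭 κ γ Dt.f ΩK' Ωp' L' ∧
      ∃ u : (PowerSeries (PowerSeries (unrIntegers 3)))ˣ,
        L₂ - u * PowerSeries.map (PowerSeries.C (R := unrIntegers 3)) L' ∈
          Ideal.span {T₂ (unrIntegers 3) - ((1 + T₁ (unrIntegers 3)) ^ (3 ^ k) - 1)} :=
  toricTwoVarL_of_pieces stub_toricExists stub_lineRestrictionIsBDP stub_rankinSelbergContinuation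

/-- **The honest residue of line `thin_comb` after v5.1** (kernel-checked, sorry-free — «ClosedModuloV5»): the crux
`AdditiveSplitIMCInclusionAtThree` follows from THREE PUBLISHED NAMED FACTS (Jacquet 1972 Cor. 19.15; Greenberg 2016 Prop. 4.1.1;
Tate's global Euler–Poincaré characteristic at totally complex fields, Milne ADT I Thm. 5.1), the K3b statement (CLOSED at
evidence level: utd-idea g46 #53 `k3b_holds`; pass it once landed), and the TWO research statements K3a (`stub_toricExists`) and
K2⁺⊕K4 (`stub_combDivisibility`) — via the lead's landed
`…ThinCombLine.AdditiveSplitIMCInclusionAtThree_of_toricTwoVarL_of_combDivisibility_of_prop411_of_tateTC` (p702745).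
[cite: Jacquet1972, §19 Cor. 19.15] [cite: Greenberg2016Selmer, Prop. 4.1.1] [cite: MilneADT2006, I Thm. 5.1 (p. 67)] -/
theorem AdditiveSplitIMCInclusionAtThree_of_facts (hJ : jacquet1972_exists_entire_rankinSelbergHecke)
    (h411 : Literature.NumberTheory.IwasawaTheory.Greenberg2016.prop411_selmer_isAlmostDivisible)
    (hT : ∀ (L : Type) [Field L] [NumberField L] [IsTotallyComplex L],
      Literature.NumberTheory.GaloisCohomology.tateGlobalEulerPoincareCharacteristic L)
    (hK3a :
      ∀ (W : WeierstrassCurve ℚ) [W.IsElliptic] [W.IsGloballyMinimal] (N : ℕ) [NeZero N] (K : Type) [Field K]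
        [NumberField K] (Dt : Literature.NumberTheory.EllipticCurves.ModularForms.ModularParametrizationData W N),
      Summit.BirchSwinnertonDyer.Rank1Residual.Additive.ClassO6 W 3 → W.HasSurjectiveModNGaloisRep 3 →
      W.analyticRank = 1 → W.conductorNorm ℤ = N → IsImaginaryQuadratic K → SatisfiesHeegnerHypothesis N K →
      ∀ (κ : ZpExtension K 3), κ.IsAnticyclotomic → ∀ (γ : Field.absoluteGaloisGroup K) [Fact (κ.IsTopGenerator γ)]
        (𝔭 : HeightOneSpectrum (𝓞 K)), ((3 : ℕ) : 𝓞 K) ∈ 𝔭.asIdeal →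
        𝔭.asIdeal.ramificationIdx (𝓞 ℚ) = 1 → 𝔭.asIdeal.inertiaDeg (𝓞 ℚ) = 1 →
      ∀ (𝔭' : HeightOneSpectrum (𝓞 K)), ((3 : ℕ) : 𝓞 K) ∈ 𝔭'.asIdeal → 𝔭' ≠ 𝔭 →
      ∀ (ι' : PadicAlgCl 3 ≃+* ℂ), Summit.BirchSwinnertonDyer.BirchSwinnertonDyer.Theorems.SchneiderFree.BranchInducesPrime 3 ι' 𝔭 →
      ∀ (κ₁ κ₂ : ZpExtension K 3) (γ₁ γ₂ : Field.absoluteGaloisGroup K) (k : ℕ)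
        [Fact (ZpExtension.IsTopGeneratorPair κ₁ κ₂ γ₁ γ₂)],
      (∀ v : HeightOneSpectrum (𝓞 K), v ≠ 𝔭 → ∀ 𝔓 ∈ v.primesAbove,
          𝔓.inertia (Field.absoluteGaloisGroup K) ≤ κ₁.kerSubgroup) →
      ZpExtension.pairKer κ₁ κ₂ ≤ κ.kerSubgroup → γ₁ * γ⁻¹ ∈ κ.kerSubgroup → γ₂ * (γ ^ (3 ^ k))⁻¹ ∈ κ.kerSubgroup →
      ∃ (ΩK' : ℂ) (Ωp' : ℂ_[3]) (L₂ : PowerSeries (PowerSeries (unrIntegers 3))),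
        ΩK' ≠ 0 ∧ Ωp' ≠ 0 ∧ IsToricTwoVarLFunction ι' 𝔭 𝔭' κ₁ κ₂ γ₁ γ₂ Dt.f ΩK' Ωp' L₂)
    (hK3b :
      ∀ (K : Type) [Field K] [NumberField K] (N : ℕ) (f : CuspForm (CongruenceSubgroup.Gamma0 N) 2),
      IsImaginaryQuadratic K →
      ∀ (κ : ZpExtension K 3), κ.IsAnticyclotomic → ∀ (γ : Field.absoluteGaloisGroup K), κ.IsTopGenerator γ →
      ∀ (𝔭 : HeightOneSpectrum (𝓞 K)), ((3 : ℕ) : 𝓞 K) ∈ 𝔭.asIdeal →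
        𝔭.asIdeal.ramificationIdx (𝓞 ℚ) = 1 → 𝔭.asIdeal.inertiaDeg (𝓞 ℚ) = 1 →
      ∀ (𝔭' : HeightOneSpectrum (𝓞 K)), ((3 : ℕ) : 𝓞 K) ∈ 𝔭'.asIdeal → 𝔭' ≠ 𝔭 →
      ∀ (ι : PadicAlgCl 3 ≃+* ℂ) (κ₁ κ₂ : ZpExtension K 3) (γ₁ γ₂ : Field.absoluteGaloisGroup K) (k : ℕ),
      ZpExtension.IsTopGeneratorPair κ₁ κ₂ γ₁ γ₂ →
      ZpExtension.pairKer κ₁ κ₂ ≤ κ.kerSubgroup → γ₁ * γ⁻¹ ∈ κ.kerSubgroup → γ₂ * (γ ^ (3 ^ k))⁻¹ ∈ κ.kerSubgroup →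
      RankinSelbergContinuation K f →
      ∀ (ΩK : ℂ) (Ωp : ℂ_[3]) (L₂ : PowerSeries (UnrSeries 3)), ΩK ≠ 0 → Ωp ≠ 0 →
        IsToricTwoVarLFunction ι 𝔭 𝔭' κ₁ κ₂ γ₁ γ₂ f ΩK Ωp L₂ →
        IsBDPLFunction ι 𝔭 κ γ f ΩK Ωp (spec (3 ^ k) L₂))
    (hK2 :
      ∀ (W : WeierstrassCurve ℚ) [W.IsElliptic] [W.IsGloballyMinimal] (N : ℕ) [NeZero N] (K : Type) [Field K]
        [NumberField K] (Dt : Literature.NumberTheory.EllipticCurves.ModularForms.ModularParametrizationData W N),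
      Summit.BirchSwinnertonDyer.Rank1Residual.Additive.ClassO6 W 3 → W.HasSurjectiveModNGaloisRep 3 →
      W.analyticRank = 1 → W.conductorNorm ℤ = N → IsImaginaryQuadratic K → SatisfiesHeegnerHypothesis N K →
      ∀ (𝔭 : HeightOneSpectrum (𝓞 K)), ((3 : ℕ) : 𝓞 K) ∈ 𝔭.asIdeal →
        𝔭.asIdeal.ramificationIdx (𝓞 ℚ) = 1 → 𝔭.asIdeal.inertiaDeg (𝓞 ℚ) = 1 →
      ∀ (𝔭' : HeightOneSpectrum (𝓞 K)), ((3 : ℕ) : 𝓞 K) ∈ 𝔭'.asIdeal → 𝔭' ≠ 𝔭 →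
      ∀ (ι' : PadicAlgCl 3 ≃+* ℂ), Summit.BirchSwinnertonDyer.BirchSwinnertonDyer.Theorems.SchneiderFree.BranchInducesPrime 3 ι' 𝔭 →
      ∀ (κ₁ κ₂ : ZpExtension K 3) (γ₁ γ₂ : Field.absoluteGaloisGroup K)
        [Fact (ZpExtension.IsTopGeneratorPair κ₁ κ₂ γ₁ γ₂)],
      (∀ v : HeightOneSpectrum (𝓞 K), v ≠ 𝔭 → ∀ 𝔓 ∈ v.primesAbove,
          𝔓.inertia (Field.absoluteGaloisGroup K) ≤ κ₁.kerSubgroup) →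
      ∀ (g : IwasawaAlgebra₂ 3),
        Literature.NumberTheory.EllipticCurves.Module.charIdeal (IwasawaAlgebra₂ 3)
          ((W.baseChange K).XGr₂ 3 κ₁ κ₂ 𝔭' γ₁ γ₂) = Ideal.span {g} →
      ∀ (ΩK : ℂ) (Ωp : ℂ_[3]) (L₂ : PowerSeries (PowerSeries (unrIntegers 3))), ΩK ≠ 0 → Ωp ≠ 0 →
        IsToricTwoVarLFunction ι' 𝔭 𝔭' κ₁ κ₂ γ₁ γ₂ Dt.f ΩK Ωp L₂ →
      Module.IsTorsion (IwasawaAlgebra₂ 3) ((W.baseChange K).XGr₂ 3 κ₁ κ₂ 𝔭' γ₁ γ₂) ∧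
      ∃ (ρ : PowerSeries (PowerSeries (unrIntegers 3)) ≃+* PowerSeries (PowerSeries (unrIntegers 3))),
        (∀ c : unrIntegers 3, ρ (const (unrIntegers 3) c) = const (unrIntegers 3) c) ∧
        ρ (T₂ (unrIntegers 3)) ∉ Ideal.span {const (unrIntegers 3) ((3 : ℕ) : unrIntegers 3), T₂ (unrIntegers 3)} ∧
        Associated (ρ (PowerSeries.map (PowerSeries.map
          (Summit.BirchSwinnertonDyer.Rank1Residual.X11b.Halves.toUnr 3)) g))
          (PowerSeries.map (PowerSeries.map (Summit.BirchSwinnertonDyer.Rank1Residual.X11b.Halves.toUnr 3)) g) ∧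
        Associated (ρ L₂) L₂ ∧
        ThinCombDvdInt (unrIntegers 3) 3
          (PowerSeries.map (PowerSeries.map (Summit.BirchSwinnertonDyer.Rank1Residual.X11b.Halves.toUnr 3)) g) L₂) :
    Summit.BirchSwinnertonDyer.BirchSwinnertonDyer.Theses.UniversalToricDescent.AdditiveSplitIMCInclusionAtThree :=
  Summit.BirchSwinnertonDyer.BirchSwinnertonDyer.Theorems.UniversalToricDescentThinCombLine.AdditiveSplitIMCInclusionAtThree_of_toricTwoVarL_of_combDivisibility_of_prop411_of_tateTC
    (toricTwoVarL_of_pieces hK3a hK3b (rankinSelbergContinuation_of_jacquet hJ)) hK2 h411 hT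


/-- **Composition** (kernel-checked, no `sorry` outside the stubs; v4): the seven stubs give the crux BY NAME; the
∀-frame universality is discharged by `span_singleton_eq_of_isBDPLFunction`. -/
theorem AdditiveSplitIMCInclusionAtThree_of :
    Summit.BirchSwinnertonDyer.BirchSwinnertonDyer.Theses.UniversalToricDescent.AdditiveSplitIMCInclusionAtThree := by
  intro W _ _ N _ K _ _ Dt hO6 hsurj hrk hN hK hH κ hκ γ hγ 𝔭 h3 hram hdeg 𝔭' h3' hne ι' hι ΩK Ωp L hΩK hΩp hL
  obtain ⟨κ₁, κ₂, γ₁, γ₂, k, hpair, hur₁, hker, hγ₁, hγ₂⟩ :=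
    Summit.BirchSwinnertonDyer.BirchSwinnertonDyer.Theorems.UniversalToricDescentThinCombLine.stub_frame K hK κ hκ γ hγ.out 𝔭 h3 𝔭' h3' hne
  haveI : Fact (ZpExtension.IsTopGeneratorPair κ₁ κ₂ γ₁ γ₂) := ⟨hpair⟩
  obtain ⟨g, hg⟩ := (Summit.BirchSwinnertonDyer.BirchSwinnertonDyer.Theorems.UniversalToricDescentThinCombLine.stub_charIdealPrincipal ((W.baseChange K).XGr₂ 3 κ₁ κ₂ 𝔭' γ₁ γ₂))
  have hg' : Literature.NumberTheory.EllipticCurves.Module.charIdeal (IwasawaAlgebra₂ 3)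
      ((W.baseChange K).XGr₂ 3 κ₁ κ₂ 𝔭' γ₁ γ₂) = Ideal.span {g} := by
    simpa [Ideal.submodule_span_eq] using hg
  have hfin : Module.Finite (IwasawaAlgebra₂ 3) ((W.baseChange K).XGr₂ 3 κ₁ κ₂ 𝔭' γ₁ γ₂) :=
    Summit.BirchSwinnertonDyer.BirchSwinnertonDyer.Theorems.SignedBaseChangeAcDivFinitePiece.xGr₂_module_finite
      (W.baseChange K) 3 κ₁ κ₂ 𝔭'
  obtain ⟨ΩK', Ωp', L₂, L', hΩK', hΩp', hL₂, hL', hcong⟩ :=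
    toricTwoVarL_of_split W N K Dt hO6 hsurj hrk hN hK hH κ hκ γ 𝔭 h3 hram hdeg 𝔭' h3' hne ι' hι κ₁ κ₂ γ₁ γ₂ k
      hur₁ hker hγ₁ hγ₂ ΩK Ωp L hΩK hΩp hL
  -- cross-period rigidity (tree theorem, utd-p2 p536114): the handed frame and K3's companion span the same ideal
  have hspan : Ideal.span ({L'} : Set (UnrSeries 3)) = Ideal.span {L} :=
    Summit.BirchSwinnertonDyer.BirchSwinnertonDyer.Theorems.UniversalToricDescentTwinSplit.span_singleton_eq_of_isBDPLFunction
      hK hκ hγ.out hΩK hΩK' hΩp hΩp' hL hL'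
  obtain ⟨htors, ρ, hρc, hρT, hGsym, hLsym, hcomb⟩ :=
    stub_combDivisibility W N K Dt hO6 hsurj hrk hN hK hH 𝔭 h3 hram hdeg 𝔭' h3' hne ι' hι κ₁ κ₂ γ₁ γ₂
      hur₁ g hg' ΩK' Ωp' L₂ hΩK' hΩp' hL₂
  have hdvd := Summit.BirchSwinnertonDyer.BirchSwinnertonDyer.Theorems.UniversalToricDescentThinCombLine.stub_weakRigidity ρ hρc hρT _ L₂ hGsym hLsym hcomb
  have hPN := stub_noPseudoNull W K hO6 hsurj hK κ hκ γ 𝔭 h3 𝔭' h3' hne κ₁ κ₂ γ₁ γ₂ k hur₁ hker hγ₁ hγ₂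
    hfin htors
  rw [← hspan]
  exact Summit.BirchSwinnertonDyer.BirchSwinnertonDyer.Theorems.UniversalToricDescentThinCombLine.stub_descent W K hO6 hsurj hK κ hκ γ 𝔭 h3 𝔭' h3' hne κ₁ κ₂ γ₁ γ₂ k hur₁ hker hγ₁ hγ₂ hfin htors hPN
    g hg' L₂ L' hdvd hcong

end Summit.BirchSwinnertonDyer.BirchSwinnertonDyer.Cruxes.AdditiveSplitIMCInclusionAtThree.ThinCombV5Pen

end
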